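import Literature.MeasureTheory.Group.InvariantQuotientNormalized
import HarnessLib

/-!
# The mass of a sliced window in a coset space:
`(ν/ρ)(π(K')) · ρ(T₀) = ν(K')` when every `H`-slice of `K'` through a point of `K'` is `T₀`
(Deitmar–Echterhoff, *Principles of Harmonic Analysis* (2014), Thm. 1.5.3 (quotient integral
formula), applied to `f = 1_{K'}`)

Topic `MeasureTheory/Group`; namespace `Literature.MeasureTheory.Group`. Theorems only (no
definition, no named fact, no instance). Sibling of ★ `InvariantQuotientCompactOpenMass`, which is
the case `K' = K` an open SUBGROUP (slice `T₀ = H ∩ K`). Setting of `InvariantQuotientNormalized`: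
`G` a locally compact second countable Hausdorff group with Borel σ-algebra, `H ≤ G` a closed
subgroup with a left-invariant measure `ρ` (finite on compacts, positive on opens, inversion
invariant), `ν` a Haar measure on `G` which is also right invariant,
`ν/ρ = quotientMeasure H ρ hH ν` the invariant measure on `G ⧸ H` satisfying Weil's formula with
constant one (`lintegral_fiberLIntegral_quotientMeasure`).

THE SLICE HYPOTHESIS. For a measurable `K' ⊆ G` and a measurable `T₀ ⊆ H` suppose
`∀ k ∈ K', {h ∈ H | k h ∈ K'} = T₀` — every `H`-slice of `K'` through a point of `K'` is the same
set `T₀` (for a subgroup `K' = K` this holds with `T₀ = H ∩ K`; for a "window" `K' = c(𝔪₀ ⊕ 𝔱₀)`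
of a chart adapted to `H` it holds with `T₀ = c(𝔱₀)`). Then the fibre integral of `1_{K'}` is
`ρ(T₀) · 1_{π(K')}` (`fiberLIntegral_indicator_eq_of_slice`) and Weil's formula on `f = 1_{K'}`
gives

* `measure_image_mk_mul_eq_unfoldingConstant_mul_of_slice` — `μ(π(K')) · ρ(T₀) = c_μ · ν(K')` for
  ANY `G`-invariant `μ` on `G ⧸ H` finite on compacts (`c_μ` the unfolding constant);
* `quotientMeasure_image_mk_mul_eq_of_slice` — **`(ν/ρ)(π(K')) · ρ(T₀) = ν(K')`**;
* `quotientMeasure_image_mk_eq_div_of_slice` — **`(ν/ρ)(π(K')) = ν(K') / ρ(T₀)`** when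
  `0 < ρ(T₀) < ∞`, and `measure_eq_quotientMeasure_image_mk_mul_of_slice` (the product form read
  from the right).

Here `π(K') = QuotientGroup.mk '' K'` (measurable as soon as `K'` is open:
`measurableSet_image_mk_of_isOpen'`). Purpose (HCML F0, crux H413, LH6 organ (S-𝔇), ROAD
«JAC-ELL» (LH5-p02 (g6)) brick (Q1) «QUOTIENT NORMALISATION», memo v1 §2 (2)): with `G = U′`,
`H = T = Z(γ₀)` a compact Cartan subgroup, `K' = c(Λ′₀)` the Cayley window of the sub-box
`𝔪₀ ⊕ 𝔱₀` and `T₀ = K_T = c(𝔱₀)`, it gives `μ₀(A₀) = ν(K') / tm(K_T)` for `A₀ = π(K')`.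

## References

* A. Deitmar, S. Echterhoff, *Principles of Harmonic Analysis*, 2nd ed. (2014), Thm. 1.5.3
  [DeitmarEchterhoff2014].
* J. D. Rogawski, *Automorphic Representations of Unitary Groups in Three Variables* (1990), §4.3
  p. 43 (measure normalisations) [Rogawski1990].
-/

noncomputable section

open _root_.MeasureTheory _root_.MeasureTheory.Measure _root_.Topology Set Filter
open scoped ENNReal NNReal Pointwise

namespace Literature.MeasureTheory.Group

/-! ### The fibre integral of the indicator of a sliced window -/

section Fiber

variable {G : Type*} [Group G] [MeasurableSpace G] (H : Subgroup G) [MeasurableMul H]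
  (ρ : Measure H) [ρ.IsMulLeftInvariant]

omit [MeasurableSpace G] [MeasurableMul H] in
/-- Under the slice identity `{h ∈ H | g h ∈ K'} = T₀` the integrand `h ↦ 1_{K'}(g h)` of the
fibre integral is the indicator of `T₀`. [folklore] -/
private theorem indicator_mul_eq_indicator_of_slice (K' : Set G) (T₀ : Set H) {g : G}
    (hg : {h : H | g * (h : G) ∈ K'} = T₀) :
    (fun h : H => K'.indicator (1 : G → ℝ≥0∞) (g * (h : G))) = T₀.indicator (1 : H → ℝ≥0∞) := by
  funext h
  have hiff : g * (h : G) ∈ K' ↔ h ∈ T₀ := by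
    rw [← hg]
    rfl
  by_cases hh : h ∈ T₀
  · rw [Set.indicator_of_mem (hiff.2 hh), Set.indicator_of_mem hh]
    rfl
  · rw [Set.indicator_of_notMem (mt hiff.1 hh), Set.indicator_of_notMem hh]

/-- **The fibre integral of `1_{K'}` at a point of `K'`** under the slice identity at that point:
`∫_H 1_{K'}(g h) dρ(h) = ρ(T₀)`. [cite: DeitmarEchterhoff2014, Thm. 1.5.3] -/
theorem fiberLIntegral_indicator_mk_of_slice (K' : Set G) {T₀ : Set H} (hT₀ : MeasurableSet T₀)
    {g : G} (hslice : {h : H | g * (h : G) ∈ K'} = T₀) :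
    fiberLIntegral H ρ (K'.indicator 1) (QuotientGroup.mk g) = ρ T₀ := by
  rw [fiberLIntegral_mk, indicator_mul_eq_indicator_of_slice H K' T₀ hslice,
    lintegral_indicator_one hT₀]

/-- **The fibre integral of `1_{K'}` everywhere**: if every slice of `K'` through a point of `K'`
is `T₀` then `∫_H 1_{K'}(g h) dρ(h) = ρ(T₀) · 1_{π(K')}(gH)` — on the image of `K'` in `G ⧸ H` it
is `ρ(T₀)` (choose the representative in `K'`), off the image it vanishes
(`fiberLIntegral_indicator_eq_zero`). [cite: DeitmarEchterhoff2014, Thm. 1.5.3] -/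
theorem fiberLIntegral_indicator_eq_of_slice (K' : Set G) {T₀ : Set H} (hT₀ : MeasurableSet T₀)
    (hslice : ∀ k ∈ K', {h : H | k * (h : G) ∈ K'} = T₀) (x : G ⧸ H) :
    fiberLIntegral H ρ (K'.indicator 1) x =
      ρ T₀ * ((QuotientGroup.mk : G → G ⧸ H) '' K').indicator 1 x := by
  by_cases hx : x ∈ (QuotientGroup.mk : G → G ⧸ H) '' K'
  · obtain ⟨k, hk, rfl⟩ := hx
    rw [fiberLIntegral_indicator_mk_of_slice H ρ K' hT₀ (hslice k hk),
      Set.indicator_of_mem (Set.mem_image_of_mem _ hk), Pi.one_apply, mul_one]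
  · obtain ⟨g, rfl⟩ := QuotientGroup.mk_surjective x
    rw [fiberLIntegral_indicator_eq_zero H ρ hx, Set.indicator_of_notMem hx, mul_zero]

end Fiber

/-! ### The mass formula on `G ⧸ H` -/

section Mass

variable {G : Type*} [Group G] [TopologicalSpace G] [IsTopologicalGroup G] [LocallyCompactSpace G]
  [SecondCountableTopology G] [T2Space G] [MeasurableSpace G] [BorelSpace G]
  (H : Subgroup G) [hH : IsClosed (H : Set G)]
  (ρ : Measure H) [ρ.IsMulLeftInvariant] [IsFiniteMeasureOnCompacts ρ]
  [MeasurableSpace (G ⧸ H)] [BorelSpace (G ⧸ H)]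

omit [LocallyCompactSpace G] [SecondCountableTopology G] [T2Space G] [MeasurableSpace G] [BorelSpace G]
  hH in
/-- `π(K') ⊆ G ⧸ H` is open, hence measurable, for `K'` open (the quotient map is open).
[cite: DeitmarEchterhoff2014, Thm. 1.5.3] -/
theorem measurableSet_image_mk_of_isOpen' {K' : Set G} (hK' : IsOpen K') :
    MeasurableSet ((QuotientGroup.mk : G → G ⧸ H) '' K') :=
  (QuotientGroup.isOpenMap_coe K' hK').measurableSet

/-- **Unfolding on `1_{K'}` for any invariant measure**: for a `G`-invariant measure `μ` on `G ⧸ H`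
finite on compact sets, a measurable `K' ⊆ G` with measurable image `π(K')` and a measurable
`T₀ ⊆ H` with `{h ∈ H | k h ∈ K'} = T₀` for all `k ∈ K'`:
`μ(π(K')) · ρ(T₀) = c_μ · ν(K')`, `c_μ = unfoldingConstant H ρ μ ν`
(`lintegral_fiberLIntegral_eq_mul_lintegral` with `f = 1_{K'}`). [cite: DeitmarEchterhoff2014, Thm. 1.5.3] -/
theorem measure_image_mk_mul_eq_unfoldingConstant_mul_of_slice (μ : Measure (G ⧸ H))
    [IsFiniteMeasureOnCompacts μ] [SMulInvariantMeasure G (G ⧸ H) μ]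
    (ν : Measure G) [IsHaarMeasure ν] {K' : Set G} (hK' : MeasurableSet K')
    (hπK' : MeasurableSet ((QuotientGroup.mk : G → G ⧸ H) '' K')) {T₀ : Set H}
    (hT₀ : MeasurableSet T₀) (hslice : ∀ k ∈ K', {h : H | k * (h : G) ∈ K'} = T₀) :
    μ ((QuotientGroup.mk : G → G ⧸ H) '' K') * ρ T₀ = unfoldingConstant H ρ μ ν * ν K' := by
  have h := lintegral_fiberLIntegral_eq_mul_lintegral H ρ μ ν
    ((measurable_one.indicator hK' : Measurable (K'.indicator (1 : G → ℝ≥0∞))))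
  rw [lintegral_indicator_one hK'] at h
  have hfib : (fun x => fiberLIntegral H ρ (K'.indicator 1) x) = fun x =>
      ((QuotientGroup.mk : G → G ⧸ H) '' K').indicator 1 x * ρ T₀ := by
    funext x
    rw [fiberLIntegral_indicator_eq_of_slice H ρ K' hT₀ hslice x, mul_comm]
  rw [hfib, lintegral_mul_const _ (measurable_one.indicator hπK'), lintegral_indicator_one hπK'] at h
  exact h

variable [ρ.IsOpenPosMeasure] [ρ.IsInvInvariant] [SFinite ρ]
  (ν : Measure G) [IsHaarMeasure ν] [ν.IsMulRightInvariant]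

/-- **Mass formula for the quotient measure on a sliced window**: for a measurable `K' ⊆ G` with
measurable image and a measurable `T₀ ⊆ H` with `{h ∈ H | k h ∈ K'} = T₀` for all `k ∈ K'`,
`(ν/ρ)(π(K')) · ρ(T₀) = ν(K')` — Weil's formula with constant one
(`lintegral_fiberLIntegral_quotientMeasure`) on `f = 1_{K'}`, whose fibre integral is
`ρ(T₀) · 1_{π(K')}`. [cite: DeitmarEchterhoff2014, Thm. 1.5.3] -/
theorem quotientMeasure_image_mk_mul_eq_of_slice {K' : Set G} (hK' : MeasurableSet K')
    (hπK' : MeasurableSet ((QuotientGroup.mk : G → G ⧸ H) '' K')) {T₀ : Set H}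
    (hT₀ : MeasurableSet T₀) (hslice : ∀ k ∈ K', {h : H | k * (h : G) ∈ K'} = T₀) :
    quotientMeasure H ρ hH ν ((QuotientGroup.mk : G → G ⧸ H) '' K') * ρ T₀ = ν K' := by
  rw [measure_image_mk_mul_eq_unfoldingConstant_mul_of_slice H ρ (quotientMeasure H ρ hH ν) ν hK'
      hπK' hT₀ hslice, unfoldingConstant_quotientMeasure H ρ ν, ENNReal.coe_one, one_mul]

/-- **`(ν/ρ)(π(K')) = ν(K') / ρ(T₀)`** on a sliced window with `0 < ρ(T₀) < ∞`.
[cite: DeitmarEchterhoff2014, Thm. 1.5.3] -/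
theorem quotientMeasure_image_mk_eq_div_of_slice {K' : Set G} (hK' : MeasurableSet K')
    (hπK' : MeasurableSet ((QuotientGroup.mk : G → G ⧸ H) '' K')) {T₀ : Set H}
    (hT₀ : MeasurableSet T₀) (hslice : ∀ k ∈ K', {h : H | k * (h : G) ∈ K'} = T₀)
    (h0 : ρ T₀ ≠ 0) (htop : ρ T₀ ≠ ∞) :
    quotientMeasure H ρ hH ν ((QuotientGroup.mk : G → G ⧸ H) '' K') = ν K' / ρ T₀ := by
  rw [← quotientMeasure_image_mk_mul_eq_of_slice H ρ ν hK' hπK' hT₀ hslice]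
  exact (ENNReal.mul_div_cancel_right h0 htop).symm

/-- **The window mass read from the right**: `ν(K') = (ν/ρ)(π(K')) · ρ(T₀)` — the form consumed by
a tube computation `ν(Φ(A₀ × V)) = μ₀(A₀) · …` with `A₀ = π(K')`. [cite: DeitmarEchterhoff2014, Thm. 1.5.3] -/
theorem measure_eq_quotientMeasure_image_mk_mul_of_slice {K' : Set G} (hK' : MeasurableSet K')
    (hπK' : MeasurableSet ((QuotientGroup.mk : G → G ⧸ H) '' K')) {T₀ : Set H}
    (hT₀ : MeasurableSet T₀) (hslice : ∀ k ∈ K', {h : H | k * (h : G) ∈ K'} = T₀) :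
    ν K' = quotientMeasure H ρ hH ν ((QuotientGroup.mk : G → G ⧸ H) '' K') * ρ T₀ :=
  (quotientMeasure_image_mk_mul_eq_of_slice H ρ ν hK' hπK' hT₀ hslice).symm

/-- **Positivity and finiteness of the window class**: on a sliced window with `0 < ν(K') < ∞` and
`0 < ρ(T₀) < ∞` the class `A₀ = π(K')` has `0 < (ν/ρ)(A₀) < ∞` — the two side conditions of the
local tube-Jacobian socket. [cite: DeitmarEchterhoff2014, Thm. 1.5.3] -/
theorem quotientMeasure_image_mk_ne_zero_ne_top_of_slice {K' : Set G} (hK' : MeasurableSet K')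
    (hπK' : MeasurableSet ((QuotientGroup.mk : G → G ⧸ H) '' K')) {T₀ : Set H}
    (hT₀ : MeasurableSet T₀) (hslice : ∀ k ∈ K', {h : H | k * (h : G) ∈ K'} = T₀)
    (hν0 : ν K' ≠ 0) (hνtop : ν K' ≠ ∞) (h0 : ρ T₀ ≠ 0) (htop : ρ T₀ ≠ ∞) :
    quotientMeasure H ρ hH ν ((QuotientGroup.mk : G → G ⧸ H) '' K') ≠ 0 ∧
      quotientMeasure H ρ hH ν ((QuotientGroup.mk : G → G ⧸ H) '' K') ≠ ∞ := by
  rw [quotientMeasure_image_mk_eq_div_of_slice H ρ ν hK' hπK' hT₀ hslice h0 htop]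
  exact ⟨(ENNReal.div_pos hν0 htop).ne', ENNReal.div_ne_top hνtop h0⟩

end Mass


/-! ### Windows inside an open subgroup: the slice hypothesis from right-stability -/

section Window

variable {G : Type*} [Group G] (H : Subgroup G)

/-- **The slice of a right-stable window inside a subgroup**: if `K' ⊆ K` for a subgroup `K ≤ G` and the
window `K'` is stable under right multiplication by `H ∩ K` (`k ∈ K'`, `h ∈ H ∩ K` ⇒ `k h ∈ K'`), then for every
`k ∈ K'` the `H`-slice `{h ∈ H | k h ∈ K'}` is exactly `H ∩ K` (`⊆`: `h = k⁻¹ (k h) ∈ K` by the group property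
of `K`). This is the slice identity of a chart window `K' = c(𝔪₀) c(𝔱₀)` inside the compact open subgroup
`K = c(𝔤₀)` with `H ∩ K = c(𝔱₀)`. [cite: DeitmarEchterhoff2014, Thm. 1.5.3] -/
theorem slice_eq_preimage_of_subset_subgroup (K : Subgroup G) {K' : Set G} (hK'K : K' ⊆ K)
    (hstab : ∀ k ∈ K', ∀ h : H, (h : G) ∈ K → k * (h : G) ∈ K') {k : G} (hk : k ∈ K') :
    {h : H | k * (h : G) ∈ K'} = Subtype.val ⁻¹' (K : Set G) := by
  ext h
  constructor
  · intro hkh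
    have h1 : k⁻¹ * (k * (h : G)) ∈ K := K.mul_mem (K.inv_mem (hK'K hk)) (hK'K hkh)
    rwa [inv_mul_cancel_left] at h1
  · intro hh
    exact hstab k hk h hh

end Window

section WindowMass

variable {G : Type*} [Group G] [TopologicalSpace G] [IsTopologicalGroup G] [LocallyCompactSpace G]
  [SecondCountableTopology G] [T2Space G] [MeasurableSpace G] [BorelSpace G]
  (H : Subgroup G) [hH : IsClosed (H : Set G)]
  (ρ : Measure H) [ρ.IsMulLeftInvariant] [IsFiniteMeasureOnCompacts ρ] [ρ.IsOpenPosMeasure] [ρ.IsInvInvariant]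
  [SFinite ρ] (ν : Measure G) [IsHaarMeasure ν] [ν.IsMulRightInvariant]
  [MeasurableSpace (G ⧸ H)] [BorelSpace (G ⧸ H)]

/-- **Mass of an open window inside an open subgroup**: for an open subgroup `K ≤ G` and an open window
`K' ⊆ K` stable under right multiplication by `H ∩ K`,
**`ν(K') = (ν/ρ)(π(K')) · ρ(H ∩ K)`** (`measure_eq_quotientMeasure_image_mk_mul_of_slice` with the slice
`T₀ = H ∩ K` supplied by `slice_eq_preimage_of_subset_subgroup`). With `K' = K` this is ★
`quotientMeasure_image_mk_mul_eq`. [cite: DeitmarEchterhoff2014, Thm. 1.5.3] [cite: Rogawski1990, §4.3 (p. 43)] -/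
theorem measure_eq_quotientMeasure_image_mk_mul_of_window (K : Subgroup G) (hK : IsOpen (K : Set G))
    {K' : Set G} (hK'o : IsOpen K') (hK'K : K' ⊆ K)
    (hstab : ∀ k ∈ K', ∀ h : H, (h : G) ∈ K → k * (h : G) ∈ K') :
    ν K' = quotientMeasure H ρ hH ν ((QuotientGroup.mk : G → G ⧸ H) '' K') *
      ρ (Subtype.val ⁻¹' (K : Set G)) :=
  measure_eq_quotientMeasure_image_mk_mul_of_slice H ρ ν hK'o.measurableSet
    (measurableSet_image_mk_of_isOpen' H hK'o) ((hK.preimage continuous_subtype_val).measurableSet)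
    fun _ hk => slice_eq_preimage_of_subset_subgroup H K hK'K hstab hk

/-- **The window class in the quotient**: under the same hypotheses with `K` moreover compact and `K'`
non-empty, `(ν/ρ)(π(K')) = ν(K') / ρ(H ∩ K)` and `0 < (ν/ρ)(π(K')) < ∞` (`0 < ρ(H ∩ K) < ∞` for `K` compact
open, `0 < ν(K') ≤ ν(K) < ∞` for `K'` open non-empty inside the compact `K`).
[cite: DeitmarEchterhoff2014, Thm. 1.5.3] -/
theorem quotientMeasure_image_mk_window_eq_div_and_ne (K : Subgroup G) (hK : IsOpen (K : Set G))
    (hKc : IsCompact (K : Set G)) {K' : Set G} (hK'o : IsOpen K') (hK'ne : K'.Nonempty) (hK'K : K' ⊆ K)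
    (hstab : ∀ k ∈ K', ∀ h : H, (h : G) ∈ K → k * (h : G) ∈ K') :
    quotientMeasure H ρ hH ν ((QuotientGroup.mk : G → G ⧸ H) '' K') =
        ν K' / ρ (Subtype.val ⁻¹' (K : Set G)) ∧
      quotientMeasure H ρ hH ν ((QuotientGroup.mk : G → G ⧸ H) '' K') ≠ 0 ∧
      quotientMeasure H ρ hH ν ((QuotientGroup.mk : G → G ⧸ H) '' K') ≠ ∞ := by
  have hT₀ : MeasurableSet (Subtype.val ⁻¹' (K : Set G) : Set H) :=
    (hK.preimage continuous_subtype_val).measurableSet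
  have h0 : ρ (Subtype.val ⁻¹' (K : Set G)) ≠ 0 :=
    ((hK.preimage continuous_subtype_val).measure_pos ρ ⟨1, show ((1 : H) : G) ∈ K from K.one_mem⟩).ne'
  have htop : ρ (Subtype.val ⁻¹' (K : Set G)) ≠ ∞ :=
    (hH.isClosedEmbedding_subtypeVal.isCompact_preimage hKc).measure_lt_top.ne
  have hslice : ∀ k ∈ K', {h : H | k * (h : G) ∈ K'} = Subtype.val ⁻¹' (K : Set G) :=
    fun _ hk => slice_eq_preimage_of_subset_subgroup H K hK'K hstab hk
  refine ⟨quotientMeasure_image_mk_eq_div_of_slice H ρ ν hK'o.measurableSet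
      (measurableSet_image_mk_of_isOpen' H hK'o) hT₀ hslice h0 htop, ?_⟩
  exact quotientMeasure_image_mk_ne_zero_ne_top_of_slice H ρ ν hK'o.measurableSet
    (measurableSet_image_mk_of_isOpen' H hK'o) hT₀ hslice (hK'o.measure_pos ν hK'ne).ne'
    ((measure_mono hK'K).trans_lt hKc.measure_lt_top).ne h0 htop

end WindowMass

end Literature.MeasureTheory.Group
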